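import Summits.ABC.StewartYu.PadicG3TwoBasisStepR
import Summits.ABC.StewartYu.PadicG3TwoRecordMono
import HarnessLib

/-!
# Cell abc-stewartyu, Gen-3 frame at `p = 2` (crux `Y07Two`, stmt-ABC-19659), assembly v2: the frame reduced to the
# record — `FrameNumericsTwoR` (base-relative re-indexing, sharp count, shrinking boxes) and the registered stub

`Summits/ABC/StewartYu/PadicG3TwoFrameNumericsR.lean` — cell `abc-stewartyu` (HOME `run/shared/lean/pub/abc-stewartyu/`),
route `PadicPrimesKummerThird`, seat p5 (g3); v2 of `PadicG3TwoFrameNumerics(Sharp)` after p1-g7's record flag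
(2026-08-27T02:31Z).  One `Prop`-structure and theorems; no named fact.

`FrameNumericsTwoR σ H L₀` = `FrameNumericsTwoC` with (i) the third-step obligations in the v2 form `ThirdFinalTwoR`
(no box recursion) and (ii) the BOX SLOTS `2·Dbox 0 j/3^{I+1} ≤ Dbox (I+1) j`, `2·Dθ 0/3^{I+1} ≤ Dθ (I+1)` for
`I < I*` — the boxes of the deep levels may be `0` (Nesterenko (4.35)), which is what lets the far-height line of the
record decay.  `levels_of_numericsR` (Siegel with `ShFeldR`, inner chains, third steps v2), and — with the monotone
record slot of `PadicG3TwoRecordMono` — **`frameTwoLast_of_numericsR`**, **`stub_frameTwoLast_of_numericsR`**: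
the registered stub `stub_frameTwoLast` of crux stmt-ABC-19659 from admissible `C` + per datum
`∃ σ H L₀ S₀ X D₀′ D′, FrameNumericsTwoR σ H L₀ ∧ ‖Λ₀‖ ≤ 2^{−(m+3)} ∧ END ranges ∧ σ.D₀ ≤ D₀′ ∧ END box ≤ D′ ∧
RecordTwo C (d+1) V Vmax W D₀′ S₀ X D′`.  THIS is the form the record (p1 / lp-1 / p3-g6) should instantiate.

WHAT THIS IS NOT: no numbers; no crux moves.

References: K. Yu, Acta Math. 211 (2013), §3.1, §5–§6; Yu. V. Nesterenko, LNM 1819 (2003), §4.3 (4.35), §5.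
-/

noncomputable section

open Finset Polynomial
open Literature.NumberTheory.Transcendental
open Literature.NumberTheory.Transcendental (FeldmanDelta.den)
open Literature.NumberTheory.Transcendental.FeldmanDelta
open Literature.NumberTheory.Transcendental.CW77.Setup (Tau tauNorm)

namespace Summit.ABC.StewartYu

namespace TwoSetup

open Summit.ABC.StewartYu.FeldmanBasis Summit.ABC.StewartYu.G3Boxes

variable {S : TwoSetup} (σ : S.G3TwoSched)

/-- **THE RECORD'S COMPLETE OBLIGATION LIST FOR THE ANALYTIC FRAME (v2)**: sharp Siegel count, pre-scaled
Fel'dman `Y₀`-weights, inner chains, third steps WITHOUT box recursion, and the shrinking box slots.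
[cite: Yu2013, §3.1 (3.1)–(3.9) and (4.30); shape only] -/
structure FrameNumericsTwoR (H L₀ : ℕ) : Prop where
  /-- the Fel'dman block is nonempty -/
  one_le_H : 1 ≤ H
  /-- at least one order at level `0` -/
  T0_pos : 1 ≤ σ.T0 0
  /-- Siegel's count on the slab class, sharp -/
  count : 2 * 2 ^ σ.m * ((2 * σ.N0 0 + 1) * (σ.T0 0 + S.d).choose (S.d + 1)) ≤
    (L₀ + 1) * ((∏ j, (2 * σ.Dbox 0 j + 1)) * (2 * σ.Dθ 0 + 1))
  /-- the family-size slot at level `0` -/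
  cardB0 : (famBox L₀ (σ.Dbox 0) (σ.Dθ 0)).card ≤ σ.cardB 0
  /-- the `Y₀`-degree slot -/
  L_le : L₀ ≤ σ.D₀
  /-- the directional slot at level `0` -/
  Xb0 : ∀ i ∈ famBox L₀ (σ.Dbox 0) (σ.Dθ 0), ∀ j, |S.dirScalar i.2.1 i.2.2 j| ≤ σ.Xb 0
  /-- the `2`-adic weight line at level `0` (radius `4·2^m`) -/
  Bw0 : ∀ ℓ, ℓ ≤ L₀ → ‖((den ℓ H : ℚ_[2]))⁻¹‖ * (4 * (2 : ℝ) ^ σ.m) ^ ℓ ≤ σ.Bw 0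
  /-- the `Y₀`-weight denominators are `ν(H)^t` at every level -/
  den₀_eq : ∀ (I : ℕ) (x : ℤ) (τ : Tau S.d), σ.den₀ I x τ = Nat.lcmUpto H ^ τ.1
  /-- Fel'dman's Hasse sizes at the points `3^{I*−I}x`, every level `I ≤ I*` -/
  M₀_ge : ∀ I, I ≤ σ.Istar → ∀ (x : ℤ) (τ : Tau S.d), ∀ ℓ, ℓ ≤ L₀ →
    (3 : ℝ) ^ ((σ.Istar - I) * τ.1) * ((Nat.lcmUpto H : ℝ) ^ τ.1 *
      (Real.exp (H / Real.exp 1) * (Real.exp 1 * (1 + (3 : ℝ) ^ (σ.Istar - I) * |(x : ℝ)| / H)) ^ ℓ)) ≤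
      σ.M₀ I x τ
  /-- the level-`0` Siegel size `Amax` and the coefficient slot `P` -/
  level0_size : ∃ (M₀E : ℤ) (Amax : ℝ), (∀ e ∈ eqSet S.d (σ.N0 0) (σ.T0 0), σ.M₀ 0 e.1 e.2 ≤ M₀E) ∧
    1 ≤ Amax ∧ (∀ e ∈ eqSet S.d (σ.N0 0) (σ.T0 0), (M₀E : ℝ) * (σ.Xb 0 : ℝ) ^ (∑ j, e.2.2 j) *
      ((MonomialDen.monDen S.toQ.all (S.boxExp (σ.Dbox 0) (σ.Dθ 0) e.1) : ℝ)) ^ 2 ≤ Amax) ∧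
    ⌈((famBox L₀ (σ.Dbox 0) (σ.Dθ 0)).card : ℝ) * Amax⌉ ≤ σ.P
  /-- the shrinking box slots `2·Dbox 0 j/3^{I+1} ≤ Dbox (I+1) j`, `2·Dθ 0/3^{I+1} ≤ Dθ (I+1)` -/
  box : ∀ I, I < σ.Istar → (∀ j, 2 * (σ.Dbox 0 j : ℤ) / 3 ^ (I + 1) ≤ (σ.Dbox (I + 1) j : ℤ)) ∧
    2 * (σ.Dθ 0 : ℤ) / 3 ^ (I + 1) ≤ (σ.Dθ (I + 1) : ℤ)
  /-- the inner-chain numerics of every level -/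
  kfinal : ∀ I, I ≤ σ.Istar → KFinalTwo σ I
  /-- the third-step numerics (v2) of every level below the last -/
  third : ∀ I, I < σ.Istar → ThirdFinalTwoR σ I

/-- **THE LEVELS FROM THE NUMBERS (v2).** [cite: Yu2013, §5 (5.19)–(5.20); shape only] -/
theorem levels_of_numericsR {H L₀ : ℕ} (hnum : FrameNumericsTwoR σ H L₀)
    (hΛ : ‖S.Λ₀‖ ≤ ((2 : ℝ) ^ (σ.m + 3))⁻¹)
    (hK : ∀ κ : Fin (S.d + 1) → ℕ, (∃ j, ¬ 3 ∣ κ j) → ∀ γ : ℚ, ∏ j, S.toQ.all j ^ κ j ≠ γ ^ 3) :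
    SiegelTwo σ (ShFeldR σ σ.Istar H L₀) ∧ (∀ I, I ≤ σ.Istar → KChainTwo σ (ShFeldR σ σ.Istar H L₀) I) ∧
      (∀ I, I < σ.Istar → ThirdStepTwo σ (ShFeldR σ σ.Istar H L₀) I) := by
  obtain ⟨M₀E, Amax, hM₀E, hAmax, hA, hP⟩ := hnum.level0_size
  refine ⟨?_, fun I hI => kchainTwo_of_kfinal σ _ (hnum.kfinal I hI), fun I hI => ?_⟩
  · refine siegelTwo_feldR_of_card σ H L₀ hnum.one_le_H hΛ hnum.T0_pos
      (siegel_count_choose σ.m L₀ (σ.Dbox 0) (σ.Dθ 0) (σ.N0 0) (σ.T0 0) hnum.count) hnum.cardB0 hnum.L_le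
      hnum.Xb0 hnum.Bw0 (hnum.den₀_eq 0) ?_ hM₀E hAmax hA hP
    intro x τ ℓ hℓ
    have h := hnum.M₀_ge 0 (Nat.zero_le _) x τ ℓ hℓ
    simpa only [Nat.sub_zero] using h
  · exact thirdStepTwo_ofR σ _ (hnum.third I hI)
      (basisStepTwoR_feld σ hnum.one_le_H hI (hnum.den₀_eq (I + 1)) (hnum.M₀_ge (I + 1) hI)
        (hnum.box I hI).1 (hnum.box I hI).2) hK

/-- **`FrameTwoLast C d` FROM THE RECORD (v2, monotone record slot).** [cite: Yu2013, §5–§6; shape only] -/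
theorem frameTwoLast_of_numericsR {C : ℕ → ℝ} {d : ℕ}
    (h : ∀ (α : Fin (d + 1) → ℚ) (b : Fin (d + 1) → ℤ) (V : Fin (d + 1) → ℝ) (Vmax W : ℝ)
      (hα : ∀ j, 3 ≤ padicValRat 2 (α j - 1)),
      (∀ μ : Fin (d + 1) → ℤ, ∏ j, α j ^ μ j = 1 → μ = 0) →
      (∀ κ : Fin (d + 1) → ℤ, (∃ γ : ℚ, ∏ j, α j ^ κ j = γ ^ 3) → ∀ j, (3 : ℤ) ∣ κ j) →
      (∀ j, Height.logHeight₁ (α j) ≤ V j) → (∀ j, 1 ≤ V j) → (∀ j, V j ≤ Vmax) →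
      ∀ (hb : b (Fin.last d) ≠ 0)
        (hmin : ∀ j, b j ≠ 0 → padicValInt 2 (b (Fin.last d)) ≤ padicValInt 2 (b j)),
      (∀ j, Real.log (max 3 (|b j| : ℝ)) ≤ W) → 1 ≤ W →
      ¬ (padicValRat 2 (∏ j, α j ^ b j - 1) : ℝ) ≤ C (d + 1) * (∏ j, V j) * (W + Real.log (2 * Vmax)) →
      ∃ (σ : (ofData d α b hα hb hmin).G3TwoSched) (H L₀ S₀ X D₀' : ℕ) (D' : Fin (d + 1) → ℕ),
        FrameNumericsTwoR σ H L₀ ∧ ‖(ofData d α b hα hb hmin).Λ₀‖ ≤ ((2 : ℝ) ^ (σ.m + 3))⁻¹ ∧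
        (d + 1 + 1) * X ≤ σ.Nfin σ.Istar ∧ (d + 1 + 1) * S₀ < σ.Tfin σ.Istar ∧
        σ.D₀ ≤ D₀' ∧ (∀ j, (Fin.snoc (σ.Dbox σ.Istar) (σ.Dθ σ.Istar) : Fin (d + 1) → ℕ) j ≤ D' j) ∧
        GenThreeFrameSpecTwo.RecordTwo C (d + 1) V Vmax W D₀' S₀ X D') :
    GenThreeFramePivotTwo.FrameTwoLast C d := by
  intro α b V Vmax W hα hind hKZ hV hV1 hVmax hb hmin hW hW1 hneg
  obtain ⟨σ, H, L₀, S₀, X, D₀', D', hnum, hΛ, hX, hT, hD₀, hD, hrec⟩ :=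
    h α b V Vmax W hα hind hKZ hV hV1 hVmax hb hmin hW hW1 hneg
  have hK : ∀ κ : Fin (d + 1) → ℕ, (∃ j, ¬ 3 ∣ κ j) → ∀ γ : ℚ,
      ∏ j, (ofData d α b hα hb hmin).toQ.all j ^ κ j ≠ γ ^ 3 := by
    rw [ofData_all]
    exact KummerBasisChange.kummerNat_of_kummerInt 3 α hKZ
  obtain ⟨hS, hk, hth⟩ := levels_of_numericsR σ hnum hΛ hK
  have hout := frameOutputTwo_of_mainTwo σ (ShFeldR σ σ.Istar H L₀) hS hk hth hX hT
  rw [ofData_all, ofData_ball] at hout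
  exact ⟨D₀', S₀, X, D', GenThreeFrameSpecTwo.frameOutputTwo_mono hD₀ hD hout, hrec⟩

/-- **THE REGISTERED STUB'S TEXT FROM THE RECORD (v2)** — the form to instantiate for `stub_frameTwoLast` of crux
stmt-ABC-19659. [cite: Yu2007, Main Thm (K = ℚ, ℘ = 2); shape only] -/
theorem stub_frameTwoLast_of_numericsR {C : ℕ → ℝ} {c₁ : ℝ} (hc₁ : 1 ≤ c₁)
    (hC : ∀ m, 0 ≤ C m ∧ C m ≤ c₁ ^ m) (hC1 : 4 ≤ C 1)
    (h : Nesterenko2003_prop51 → ∀ d, 1 ≤ d →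
      ∀ (α : Fin (d + 1) → ℚ) (b : Fin (d + 1) → ℤ) (V : Fin (d + 1) → ℝ) (Vmax W : ℝ)
      (hα : ∀ j, 3 ≤ padicValRat 2 (α j - 1)),
      (∀ μ : Fin (d + 1) → ℤ, ∏ j, α j ^ μ j = 1 → μ = 0) →
      (∀ κ : Fin (d + 1) → ℤ, (∃ γ : ℚ, ∏ j, α j ^ κ j = γ ^ 3) → ∀ j, (3 : ℤ) ∣ κ j) →
      (∀ j, Height.logHeight₁ (α j) ≤ V j) → (∀ j, 1 ≤ V j) → (∀ j, V j ≤ Vmax) →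
      ∀ (hb : b (Fin.last d) ≠ 0)
        (hmin : ∀ j, b j ≠ 0 → padicValInt 2 (b (Fin.last d)) ≤ padicValInt 2 (b j)),
      (∀ j, Real.log (max 3 (|b j| : ℝ)) ≤ W) → 1 ≤ W →
      ¬ (padicValRat 2 (∏ j, α j ^ b j - 1) : ℝ) ≤ C (d + 1) * (∏ j, V j) * (W + Real.log (2 * Vmax)) →
      ∃ (σ : (ofData d α b hα hb hmin).G3TwoSched) (H L₀ S₀ X D₀' : ℕ) (D' : Fin (d + 1) → ℕ),
        FrameNumericsTwoR σ H L₀ ∧ ‖(ofData d α b hα hb hmin).Λ₀‖ ≤ ((2 : ℝ) ^ (σ.m + 3))⁻¹ ∧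
        (d + 1 + 1) * X ≤ σ.Nfin σ.Istar ∧ (d + 1 + 1) * S₀ < σ.Tfin σ.Istar ∧
        σ.D₀ ≤ D₀' ∧ (∀ j, (Fin.snoc (σ.Dbox σ.Istar) (σ.Dθ σ.Istar) : Fin (d + 1) → ℕ) j ≤ D' j) ∧
        GenThreeFrameSpecTwo.RecordTwo C (d + 1) V Vmax W D₀' S₀ X D') :
    ∃ (C : ℕ → ℝ) (c₁ : ℝ), 1 ≤ c₁ ∧ (∀ m, 0 ≤ C m ∧ C m ≤ c₁ ^ m) ∧ 4 ≤ C 1 ∧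
      (Nesterenko2003_prop51 → ∀ d, 1 ≤ d → GenThreeFramePivotTwo.FrameTwoLast C d) :=
  ⟨C, c₁, hc₁, hC, hC1, fun hZ d hd => frameTwoLast_of_numericsR (h hZ d hd)⟩

end TwoSetup

end Summit.ABC.StewartYu

end
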